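import Summits.Ventures.PercRepro.RankDistLubellShadow

/-!
# PercRepro — THE LUBELL BOUND FOR THE SHADOW, SHARPENED BY THE COGIRTH (p9, gen 21)

On the tight layer `|E| = p + q`, `ρ(E) = p`, Theorem S (`card_Uq_mul_min_choose_le`) bounds the shadow level
`s_u` below by `#𝓑·min(C(n, u), C(n, p − u)) / C(n, q)`, the minimum coming from the crude size range
`u ≤ |A| ≤ u + q` of the rank-`u` shadow sets. The COGIRTH narrows that range: if every cocircuit has at least
`g + 1` elements — in the tree's vocabulary (`CogirthRLS`), every set of rank `p − 1` misses at least `g + 1`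
elements of `E` in its closure — then a set `A` of rank `u < p` misses at least `g + 1 + (p − 1 − u)` elements in
its closure (`ncard_compl_closure_of_hyperplanes`), all of them outside `A`, so `|A| + g ≤ u + q`
(`card_add_le_of_mem_rankLevelFinP_of_cogirth`). Hence
**`#𝓑·min(C(n, u), C(n, p − u + g)) ≤ s_u·C(n, q)` for every `q ≤ u < p`** (`card_Uq_mul_min_choose_le_of_cogirth`),
and the weak cumulative inequality **`#𝓑·C(n, u) ≤ s_u·C(n, q)` for every `q ≤ u < p` with `2u ≤ p + g`**
(`card_Uq_mul_choose_le_of_cogirth`) — Corollary Q's range `2u ≤ p` is the case `g = 0`; the coloop-free core has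
`g ≥ 1`, the cosimple core `g ≥ 2`, and the largest possible cogirth `q + 1` (`g = q`) gives the whole range
`2u ≤ n` below the middle. With closed bottom sets (every circuit of size `≥ q + 2` suffices) the row C-048 itself
holds there (`shadowCumulative_of_cogirth_of_closed`, `shadowCumulative_of_cogirth_of_circuits`).
Nothing here moves any window of the crux.
-/

namespace PercRepro.RankDist

open Set Finset _root_.Matroid PercRepro.ThmH

variable {α : Type} [DecidableEq α] (M : Matroid α) [M.Finite]

/-- **The cogirth bounds the size of a rank-`u` shadow set**: if every set of rank `p − 1` misses at least `g + 1`
elements of `E` in its closure, then every rank-`u` shadow set `A` with `u < p` has `|A| + g ≤ u + q`. -/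
lemma card_add_le_of_mem_rankLevelFinP_of_cogirth {p q g u : ℕ} (hn : (gr M).card = p + q)
    (hr : M.eRank = (p : ℕ∞))
    (hg : ∀ A ⊆ M.E, M.eRk A + 1 = (p : ℕ∞) → g + 1 ≤ (M.E \ M.closure A).ncard) (hup : u < p)
    {A : Finset α} (hA : A ∈ rankLevelFinP M (ContainsBottom M p q) u) : A.card + g ≤ u + q := by
  classical
  rw [mem_rankLevelFinP, mem_rankLevelFin] at hA
  obtain ⟨⟨hAE, hAu⟩, -⟩ := hA
  have hAE' : (A : Set α) ⊆ M.E := (subset_gr_iff M).1 hAE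
  -- the chain lemma: a set of rank `u = p − 1 − (p − 1 − u)` misses at least `g + 1 + (p − 1 − u)` elements
  have hchain := ncard_compl_closure_of_hyperplanes M p g hr hg (p - 1 - u) (A : Set α) hAE' (by
    rw [eRk_eq_coe_rk M hAE', hAu]
    have : u + 1 + (p - 1 - u) = p := by omega
    exact_mod_cast this)
  -- they all lie outside `A`
  have hsub : M.E \ M.closure (A : Set α) ⊆ M.E \ (A : Set α) :=
    Set.sdiff_subset_sdiff_right (M.subset_closure (A : Set α) hAE')
  have hfin : (M.E \ (A : Set α)).Finite := M.ground_finite.subset Set.sdiff_subset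
  have hle := Set.ncard_le_ncard hsub hfin
  -- `|E ∖ A| = n − |A|`
  have hcard : (M.E \ (A : Set α)).ncard = (gr M).card - A.card := by
    rw [← coe_gr, ← Finset.coe_sdiff, Set.ncard_coe_finset, Finset.card_sdiff_of_subset hAE]
  have hAle : A.card ≤ (gr M).card := Finset.card_le_card hAE
  rw [hcard, hn] at hle
  rw [hn] at hAle
  omega

/-- **The Lubell weight of the level-`u` shadow is at most `s_u / min(C(n, u), C(n, u + q − g))`** when every
cocircuit has at least `g + 1` elements (tight layer, `u < p`). -/
lemma lubellWP_mul_min_le_of_cogirth {p q g u : ℕ} (hn : (gr M).card = p + q) (hr : M.eRank = (p : ℕ∞))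
    (hg : ∀ A ⊆ M.E, M.eRk A + 1 = (p : ℕ∞) → g + 1 ≤ (M.E \ M.closure A).ncard) (hup : u < p) :
    lubellWP M (ContainsBottom M p q) u * (min ((p + q).choose u) ((p + q).choose (u + q - g)) : ℚ)
      ≤ ((shadowLev M u (PerFlat.Uq M p q)).card : ℚ) := by
  classical
  rw [← card_rankLevelFinP_containsBottom M p q u]
  unfold lubellWP
  rw [hn, Finset.sum_mul, Finset.card_eq_sum_ones, Nat.cast_sum]
  refine Finset.sum_le_sum fun A hA => ?_
  obtain ⟨h1, -⟩ := card_mem_rankLevelFinP_bounds M hn hr hA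
  have h2 := card_add_le_of_mem_rankLevelFinP_of_cogirth M hn hr hg hup hA
  have hmin : (min ((p + q).choose u) ((p + q).choose (u + q - g)) : ℚ) ≤ ((p + q).choose A.card : ℚ) := by
    exact_mod_cast choose_ge_min_of_mem_Icc h1 (by omega) (by omega)
  have hpos : (0 : ℚ) < ((p + q).choose A.card : ℚ) := by
    exact_mod_cast Nat.choose_pos (by omega)
  rw [Nat.cast_one, one_div_mul_eq_div, div_le_one hpos]
  exact hmin

/-- **THE LUBELL BOUND FOR THE SHADOW, SHARPENED BY THE COGIRTH** (tight layer, `q ≤ u < p`, every cocircuit of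
size `≥ g + 1`, `g ≤ q`): `#𝓑·min(C(n, u), C(n, p − u + g)) ≤ s_u·C(n, q)`. The case `g = 0` is Theorem S. -/
theorem card_Uq_mul_min_choose_le_of_cogirth {p q g u : ℕ} (hn : (gr M).card = p + q) (hr : M.eRank = (p : ℕ∞))
    (hg : ∀ A ⊆ M.E, M.eRk A + 1 = (p : ℕ∞) → g + 1 ≤ (M.E \ M.closure A).ncard) (hqu : q ≤ u) (hup : u < p)
    (hgq : g ≤ q) :
    (PerFlat.Uq M p q).card * min ((p + q).choose u) ((p + q).choose (p - u + g))
      ≤ (shadowLev M u (PerFlat.Uq M p q)).card * (p + q).choose q := by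
  classical
  have hmono := lubellWP_mono M (containsBottom_upClosed M p q) hr hqu hup.le
  have hq := card_Uq_div_choose_le_lubellWP M hn hr
  have hu := lubellWP_mul_min_le_of_cogirth M hn hr hg hup
  have hsymm : (p + q).choose (u + q - g) = (p + q).choose (p - u + g) := by
    rw [← Nat.choose_symm (by omega)]
    congr 1
    omega
  rw [hsymm] at hu
  have key : ((PerFlat.Uq M p q).card : ℚ) * (min ((p + q).choose u) ((p + q).choose (p - u + g)) : ℚ)
      ≤ ((shadowLev M u (PerFlat.Uq M p q)).card : ℚ) * ((p + q).choose q : ℚ) := by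
    have hminnn : (0 : ℚ) ≤ (min ((p + q).choose u) ((p + q).choose (p - u + g)) : ℚ) := by positivity
    calc ((PerFlat.Uq M p q).card : ℚ) * (min ((p + q).choose u) ((p + q).choose (p - u + g)) : ℚ)
        = (((PerFlat.Uq M p q).card : ℚ) / ((p + q).choose q : ℚ))
            * (min ((p + q).choose u) ((p + q).choose (p - u + g)) : ℚ) * ((p + q).choose q : ℚ) := by
          have hposq : (0 : ℚ) < ((p + q).choose q : ℚ) := by exact_mod_cast Nat.choose_pos (by omega)
          field_simp
      _ ≤ lubellWP M (ContainsBottom M p q) u * (min ((p + q).choose u) ((p + q).choose (p - u + g)) : ℚ)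
            * ((p + q).choose q : ℚ) := by
          gcongr
          exact hq.trans hmono
      _ ≤ ((shadowLev M u (PerFlat.Uq M p q)).card : ℚ) * ((p + q).choose q : ℚ) := by
          gcongr
  exact_mod_cast key

/-- **THE WEAK CUMULATIVE INEQUALITY UP TO `2u ≤ p + g`**: on the tight layer, if every cocircuit has at least
`g + 1` elements (`g ≤ q`), then `#𝓑·C(n, u) ≤ s_u·C(n, q)` for every `q ≤ u < p` with `2u ≤ p + g`. -/
theorem card_Uq_mul_choose_le_of_cogirth {p q g u : ℕ} (hn : (gr M).card = p + q) (hr : M.eRank = (p : ℕ∞))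
    (hg : ∀ A ⊆ M.E, M.eRk A + 1 = (p : ℕ∞) → g + 1 ≤ (M.E \ M.closure A).ncard) (hqu : q ≤ u) (hup : u < p)
    (hgq : g ≤ q) (h2u : 2 * u ≤ p + g) :
    (PerFlat.Uq M p q).card * (p + q).choose u ≤ (shadowLev M u (PerFlat.Uq M p q)).card * (p + q).choose q := by
  have h := card_Uq_mul_min_choose_le_of_cogirth M hn hr hg hqu hup hgq
  have hmin : min ((p + q).choose u) ((p + q).choose (p - u + g)) = (p + q).choose u := by
    refine min_eq_left ?_
    have h1 := choose_ge_min_of_mem_Icc (n := p + q) (a := u) (b := p + q - u) (k := p - u + g)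
      (by omega) (by omega) (by omega)
    rwa [Nat.choose_symm (by omega), min_self] at h1
  rwa [hmin] at h

/-- **C-048 up to `2u ≤ p + g` with closed bottom sets**: if every bottom set is closed and every cocircuit has at
least `g + 1` elements (`g ≤ q`), then `s_q·C(n, u) ≤ s_u·C(n, q)` for every `q ≤ u < p` with `2u ≤ p + g`. -/
theorem shadowCumulative_of_cogirth_of_closed {p q g u : ℕ} (hn : (gr M).card = p + q) (hr : M.eRank = (p : ℕ∞))
    (hg : ∀ A ⊆ M.E, M.eRk A + 1 = (p : ℕ∞) → g + 1 ≤ (M.E \ M.closure A).ncard)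
    (hcl : ∀ B ∈ PerFlat.Uq M p q, M.closure (B : Set α) = B) (hqu : q ≤ u) (hup : u < p) (hgq : g ≤ q)
    (h2u : 2 * u ≤ p + g) :
    (shadowLev M q (PerFlat.Uq M p q)).card * (p + q).choose u
      ≤ (shadowLev M u (PerFlat.Uq M p q)).card * (p + q).choose q :=
  (Nat.mul_le_mul_right _ (card_shadowLev_q_le_of_closed M hn hr hcl)).trans
    (card_Uq_mul_choose_le_of_cogirth M hn hr hg hqu hup hgq h2u)

/-- **C-048 up to `2u ≤ p + g` when every circuit has at least `q + 2` elements** and every cocircuit at least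
`g + 1` (`g ≤ q`). -/
theorem shadowCumulative_of_cogirth_of_circuits {p q g u : ℕ} (hn : (gr M).card = p + q)
    (hr : M.eRank = (p : ℕ∞))
    (hg : ∀ A ⊆ M.E, M.eRk A + 1 = (p : ℕ∞) → g + 1 ≤ (M.E \ M.closure A).ncard)
    (hcirc : ∀ C, M.IsCircuit C → ((q + 2 : ℕ) : ℕ∞) ≤ C.encard) (hqu : q ≤ u) (hup : u < p) (hgq : g ≤ q)
    (h2u : 2 * u ≤ p + g) :
    (shadowLev M q (PerFlat.Uq M p q)).card * (p + q).choose u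
      ≤ (shadowLev M u (PerFlat.Uq M p q)).card * (p + q).choose q :=
  shadowCumulative_of_cogirth_of_closed M hn hr hg (closure_Uq_eq_self_of_circuits M hn hr hcirc) hqu hup hgq h2u

end PercRepro.RankDist
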